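import Summits.QuantumFields.YangMills.Theorems.BalabanUVNodesN06AtRecord11CB10YZW
import Literature.MathematicalPhysics.QuantumFieldTheory.Balaban1983to89.B9Thm37Whole

/-!
# BalabanUVNodes ∕ N06 ([B9], `Dag.B9_main`) — OBLIGATIONS OF THE STAGE-11 CERTIFICATE KNIT AT THE RECORD:
# the `t37` leaf (Theorem 3.7) and the (3.42) half of the summation leaf `hsum` SUPPLIED BY NAME from `B9Thm37Whole`
# under the pinned convergence reading (sibling: `BalabanUVNodesN06AtRecord11SixPin` — the re-key at node00-def g32's six-pin records)

Track A of `YM-PLAN.md` (cell `pub-ymgap`, HUMAN RULING D-0062), node **N06** = [Balaban1985BackgroundPropagators] Thms 3.1–3.15; seat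
`pub-ymgap-dag-n06-d` gen 2 (director-ym LINE №80 (2): «s2 = obligations at the record»).  The ₁₁ certificate of record is
`N06AtRecord11CB10YZW.b9_main_of_up_view₁₁B10YZW_of_obligations` (p449575): `Dag.B9_main` at every run of a world bound over the four-pin Stage-11
view FROM EXACTLY 28 displayed obligations of the operator layer `ops : OpsY N θ₃ M⋆` at def-Y's bundle (index `MemberY`, THE GENUINE LATTICE NORMS
(3.39)–(3.41) `geo9Y`, backgrounds `bg9Y` in `SU(N) ⊂ M_N(ℂ)`).  Referee census of record (ref-E, pub-ymgap INBOX l.12529): k = 0 ∕ 28 inhabited AT THE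
RECORD; ONE obligation TYPED AT A PIN — `t37 : B9.Thm37Printed c35Y geo9Y bg9Y (fun x => (ops x).E37)` — by seat n06-c's `B9Thm37Whole.thm37Printed_of_local342`
(p451980 ∕ p453909) at the expansion data `E37OfOps 𝔴 𝔬 R H C δ` (convergence predicate := `Conv342`, the four (3.42) majorants of the sum (3.90)).

WHAT THIS MODULE DOES (kernel bookkeeping BY NAME; 0 `def`, 0 `sorry`, standard axioms; COUNT-NEUTRAL, `--supports` K1 `StabilityBAtRecordR11e`):
* §1 THE `t37` OBLIGATION AT THE RECORD.  Under THE PINNED CONVERGENCE READING of the layer's Theorem-3.7 letter — «`((ops x).E37).Converges U` is implied by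
  (resp. IS) `Conv342 (𝔬 x) (R x) (H x) (const37 …) ((1 − 2α)δ₀) U`» for an `Ops` record `𝔬 x` of model operators at every member `x` — n06-c's whole-statement
  glue gives `t37` AT `I := MemberY θ₃.d₆ …`, `geo := geo9Y`, `bg := bg9Y (M_N ℂ) SU(N)`, `c35 := c35Y` (its `0 < c35` DISCHARGED by `c35Y_pos`), from its five
  printed-shape schemas (`StaticOK`, `Sizes.Bounded`, [4] (2.61) `Ineq261` at the member geometry, «Cor. 3.6 for all G′_□(U)» `Local342` ∧ the (3.88)
  `Identities` under Cor. 3.6's provisos) — `thm37_obligation_of_local342`; the literal pin `(ops x).E37 = E37OfOps …` is the special case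
  `thm37_obligation_of_local342_E37OfOps`.  The finite-type structure of the record's bond-index sites is DISPLAYED as instance binders
  (`[∀ x, Fintype (geo9Y x).Site]`, inhabited by `(Node00.kGeoU x.toKIdx).fin`; `DecidableEq` likewise).
* §2 THE (3.42) HALF OF `hsum` AT THE RECORD.  `hsum : B9.RWSumsYieldIneqs geo9Y bg9Y E37 E310 Gp GA` is the by-reference summation leaf («Theorem 3.7 implies that
  all the inequalities (3.42)–(3.47) hold for G′», p. 410).  With the converse half of the pinned reading and n06-c's four CO-READINGS
  (`B9Thm37GlueCor36.CoRealizes`) of the layer's kernel family `(ops x).Gp` by the model operators G′(U), ∇_UG′(U), G′(U)∇*_U, Δ_UG′(U) of `𝔬 x`, the (3.42)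
  block of its G′-clause is a THEOREM at every U (`clause342_Gp_of_conv342`; merged to one pair of constants by `clause342_Gp_mono_pin`, the sign facts of the
  genuine norms — `d ≥ 0`, `L^jη > 0`, `|λ| ≥ 0` on `geo9Y` — DISCHARGED from dag-n03-b's `B9GeoNormsKLevelV1` ∕ `B6KLevelCensusIndexV1.len_pos`), so `hsum` follows
  from the DISPLAYED residual: (3.46) + (3.47) + the Hölder block (3.43)–(3.45) for `Gp` given convergence, and the whole `E310` ∕ `GA` clause
  (`rwSumsYieldIneqs_of_conv342_pin`).
* §3 THE KNIT AT ₁₁ WITH THESE SUPPLIED: `b9_main_of_up_view₁₁B10YZW_of_obligations_t37supplied` (the certificate with the `t37` binder REPLACED by the five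
  schemas + the pinned reading: 27 obligations + 5 schemas displayed) and `…_t37hsum342supplied` (additionally `hsum` REPLACED by the co-readings + the residual).

HONEST FRAMING.  Nothing of [B9] is proved here for Bałaban's operators: after this file the certificate reads «N06 at the record ⇐ 27 (resp. 26) operator-layer
obligations + n06-c's five printed-shape schemas for an `Ops` record `𝔬` of the record's lattice operators (+ four co-readings + the (3.43)–(3.47) residual)»; `t37` is KNIT
at `Y9OfRecord` MODULO those schemas, NOT inhabited outright — no `OpsY` ∕ `Ops` instance over the record's lattice operators exists in the tree (FAN-OUT §N06 rows (α)∕(β));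
k stays 0 ∕ 28 in the referee's sense; N06 is NOT discharged.  One finite four-torus programme at fixed `ε` — NOT ℝ⁴, NOT OS, NOT a mass gap, NOT Clay.  No `def`.
-/

noncomputable section

namespace Summit.QuantumFields.YangMills.BalabanUVNodes.N06AtRecord11Obligations

open Literature.MathematicalPhysics.QuantumFieldTheory.Balaban1983to89
open Literature.MathematicalPhysics.QuantumFieldTheory.Balaban1983to89.T4Continuum (T4Family FiniteEpsData)
open Literature.MathematicalPhysics.QuantumFieldTheory.Balaban1983to89.DagBinding (WorldP leavesP B9LeafX)
open Literature.MathematicalPhysics.QuantumFieldTheory.Balaban1983to89.Node00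
open Literature.MathematicalPhysics.QuantumFieldTheory.Balaban1983to89.B9PinMembersKLevelV1 (MemberY geo9Y bg9Y)
open Literature.MathematicalPhysics.QuantumFieldTheory.Balaban1983to89.B9PinGeometryKLevelV1 (dOmegaY OmKY inΛY unitDistY InCubeY c35Y c35Y_pos)
open Literature.MathematicalPhysics.QuantumFieldTheory.Balaban1983to89.B7Prop2SpecialUnitary (specialUnitaryUnits)
open Literature.MathematicalPhysics.QuantumFieldTheory.Balaban1983to89.B9Thm37Whole
  (Ops Conv342 E37OfOps Sizes StaticOK Local342 Identities const37 thm37Printed_of_local342)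
open Literature.MathematicalPhysics.QuantumFieldTheory.Balaban1983to89.B9Thm37GlueCor36
  (CoRealizes Clause342 clause342_mono clause342_all clause342_e0_of_hasMajorant clause342_e1_of_hasMajorantHom clause342_e2_of_hasMajorantHom
    clause342_e3_of_hasMajorantHom ineq342_346_347_of_clauses)
open Literature.MathematicalPhysics.QuantumFieldTheory.Balaban1983to89.B6RandomWalk (Ineq261 c1_nonneg)
open Literature.MathematicalPhysics.QuantumFieldTheory.Balaban1983to89.B9Thm34Ext (toB6)
open Literature.MathematicalPhysics.QuantumFieldTheory.Balaban1983to89.B9GeoNormsKLevelV1 (geo9K_dist_nonneg geo9K_supNorm_nonneg)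
open Literature.MathematicalPhysics.QuantumFieldTheory.Balaban1983to89.B6KLevelCensusIndexV1 (len_pos)
open Summit.QuantumFields.YangMills.BalabanUVNodes.N06AtRecord9CB10Y (b9LeafX_Y9OfRecord_of_obligations)
open scoped Matrix.Norms.L2Operator

variable {N : ℕ}

/-! ## §1 the `t37` obligation (Theorem 3.7 as the leaf types it) AT THE RECORD, from n06-c's whole-statement glue -/

/-- **Transport of the Theorem-3.7 leaf along a convergence implication** (bookkeeping on the typed sentence: `B9.Thm37Printed c35 geo bg E` reads `E` only through
`(E i).Converges`): if `(E′ i).Converges U → (E i).Converges U` at every member and configuration, the leaf at `E′` gives the leaf at `E`, same constants.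
[cite: Balaban1985BackgroundPropagators, Thm 3.7 p.409 (the typed sentence; bookkeeping)] -/
theorem thm37Printed_of_converges_imp {I : Type} {c35 : ℝ} {geo : I → B9.Geometry} {bg : I → B9.Backgrounds}
    {E E' : ∀ i, B9.RWExpansion (geo i) (bg i)} (h : ∀ (i : I) (U : (bg i).Cfg), (E' i).Converges U → (E i).Converges U)
    (h37 : B9.Thm37Printed c35 geo bg E') : B9.Thm37Printed c35 geo bg E := by
  obtain ⟨M₂, a₀, hM₂, ha₀, H⟩ := h37
  exact ⟨M₂, a₀, hM₂, ha₀, fun i hM α₀ hα hMa U hU => h i U (H i hM α₀ hα hMa U hU)⟩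

/-- The constant `const37 d δ₀ α ρ B₀ N N′ C_ℓ K = 2B₀(N + N′e^{δ₀ρ}C_ℓK)c₁(α)` of the inhabited leaf is nonnegative for nonnegative data. [folklore] -/
theorem const37_nonneg (d : ℕ) {δ₀ α ρ B₀ Nc N' Cℓ K : ℝ} (hB₀ : 0 ≤ B₀) (hN : 0 ≤ Nc) (hN' : 0 ≤ N') (hCℓ : 1 ≤ Cℓ) (hK : 0 ≤ K) :
    0 ≤ const37 d δ₀ α ρ B₀ Nc N' Cℓ K := by
  have hCℓ0 : 0 ≤ Cℓ := le_trans zero_le_one hCℓ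
  have hc1 : 0 ≤ B6.c1 d δ₀ α := c1_nonneg d δ₀ α
  unfold const37
  have h1 : 0 ≤ Nc + N' * Real.exp (δ₀ * ρ) * Cℓ * K :=
    add_nonneg hN (mul_nonneg (mul_nonneg (mul_nonneg hN' (Real.exp_nonneg _)) hCℓ0) hK)
  exact mul_nonneg (mul_nonneg (mul_nonneg (by norm_num) hB₀) h1) hc1

section AtBundle

variable (θ₃ : Stage3Params) (Mstar : ℕ) (ops : OpsY N θ₃ Mstar)

/-- **THE `t37` OBLIGATION OF THE CERTIFICATE AT THE RECORD'S [B9] BUNDLE, UNDER THE PINNED CONVERGENCE READING.**  For the operator layer `ops` of the record at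
`(θ₃, M⋆)` and, at every member `x`, an `Ops` record `𝔬 x` of model operators (G′(U), Δ′_a(U), G′_□(U), ∇_U, ∇*_U, Δ_U, K(h_□), the Leibniz ∕ transposed letters,
the partition data — seat n06-c's `B9Thm37Whole.Ops` over lattices `X x`, `Y x`, cube index `ι x`): IF the layer's Theorem-3.7 letter reads «`(ops x).E37` converges
at U» as implied by «the sum (3.90) obeys the four (3.42) majorants with constants `(const37 …, (1 − 2α)δ₀)`» (`hE37`), THEN `t37` — `B9.Thm37Printed c35Y geo9Y bg9Y
(fun x => (ops x).E37)` — follows from n06-c's `thm37Printed_of_local342` AT `I := MemberY`, `geo9Y`, `bg9Y (M_N ℂ) SU(N)`, `c35Y` (`0 < c35Y` discharged), i.e.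
from its displayed printed-shape schemas: static data `StaticOK`, kernel sizes `Sizes.Bounded` («M sufficiently large»), [4] Lemma 2.1 (2.61) at the member geometry
for `M ≥ M_L`, and «Corollary 3.6 for all G′_□(U)» `Local342` ∧ the (3.88) `Identities` under Cor. 3.6's provisos (`M ≥ M₁`, `O(1)Mα₀ ≤ a₁`, (3.35) — at `bg9Y` the
class (3.35) for BOTH sequences `{Ω_j}`, `{Ω′_j}`).  Nothing of print asserted; the schemas are hypotheses.
[cite: Balaban1985BackgroundPropagators, Thm 3.7 (3.90) pp.409–410, Cor. 3.6 p.408, (3.35) p.396, (3.39)–(3.41) p.397; Balaban1984PropagatorsII, Lemma 2.1 (2.61) p.234] -/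
theorem thm37_obligation_of_local342
    [∀ x : MemberY θ₃.d₆ θ₃.ℓ₆ θ₃.hd' θ₃.hL' θ₃.b₀ θ₃.b₁ Mstar, Fintype (geo9Y x).Site]
    [∀ x : MemberY θ₃.d₆ θ₃.ℓ₆ θ₃.hd' θ₃.hL' θ₃.b₀ θ₃.b₁ Mstar, DecidableEq (geo9Y x).Site]
    {X Y ι : MemberY θ₃.d₆ θ₃.ℓ₆ θ₃.hd' θ₃.hL' θ₃.b₀ θ₃.b₁ Mstar → Type}
    [∀ x, Fintype (X x)] [∀ x, DecidableEq (X x)] [∀ x, Fintype (Y x)] [∀ x, DecidableEq (Y x)] [∀ x, Fintype (ι x)]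
    (𝔬 : ∀ x, Ops (geo9Y x) (bg9Y (Matrix (Fin N) (Fin N) ℂ) (specialUnitaryUnits (Fin N)) x) (X x) (Y x) (ι x))
    (R : MemberY θ₃.d₆ θ₃.ℓ₆ θ₃.hd' θ₃.hL' θ₃.b₀ θ₃.b₁ Mstar → ℝ) (H : MemberY θ₃.d₆ θ₃.ℓ₆ θ₃.hd' θ₃.hL' θ₃.b₀ θ₃.b₁ Mstar → Prop)
    (κ : MemberY θ₃.d₆ θ₃.ℓ₆ θ₃.hd' θ₃.hL' θ₃.b₀ θ₃.b₁ Mstar → Sizes) (d : ℕ) (α ρ Nc N' Cℓ K θ₀ B₀ δ₀ a₁ M₁ ML : ℝ)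
    (hα : 0 ≤ α) (hα2 : α ≤ 1 / 2) (hN : 0 ≤ Nc) (hN' : 0 ≤ N') (hCℓ : 1 ≤ Cℓ) (hK : 0 ≤ K) (hB₀ : 0 ≤ B₀) (hδ₀ : 0 ≤ δ₀) (ha₁ : 0 < a₁) (hM₁ : 0 < M₁)
    (hst : ∀ x, StaticOK (𝔬 x) ρ Nc N' Cℓ (κ x)) (hκ : ∀ x, (κ x).Bounded K θ₀ Cℓ (geo9Y x).M)
    (h261 : ∀ x, ML ≤ (geo9Y x).M → Ineq261 d (toB6 (geo9Y x) (R x) (H x)) δ₀ α)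
    (h36 : ∀ x, M₁ ≤ (geo9Y x).M → ∀ α₀ : ℝ, 0 < α₀ → c35Y * (geo9Y x).M * α₀ ≤ a₁ →
      ∀ U : (bg9Y (Matrix (Fin N) (Fin N) ℂ) (specialUnitaryUnits (Fin N)) x).Cfg,
        (bg9Y (Matrix (Fin N) (Fin N) ℂ) (specialUnitaryUnits (Fin N)) x).Reg335 c35Y α₀ U →
          Local342 (𝔬 x) (R x) (H x) B₀ δ₀ U ∧ Identities (𝔬 x) (R x) (H x) U)
    (hE37 : ∀ (x : MemberY θ₃.d₆ θ₃.ℓ₆ θ₃.hd' θ₃.hL' θ₃.b₀ θ₃.b₁ Mstar) (U : (bg9Y (Matrix (Fin N) (Fin N) ℂ) (specialUnitaryUnits (Fin N)) x).Cfg),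
      Conv342 (𝔬 x) (R x) (H x) (const37 d δ₀ α ρ B₀ Nc N' Cℓ K) ((1 - 2 * α) * δ₀) U → ((ops x).E37).Converges U) :
    B9.Thm37Printed c35Y geo9Y (bg9Y (Matrix (Fin N) (Fin N) ℂ) (specialUnitaryUnits (Fin N))) (fun x => (ops x).E37) := by
  refine thm37Printed_of_converges_imp ?_
    (thm37Printed_of_local342 (fun x => (ops x).E37) 𝔬 R H κ d α ρ Nc N' Cℓ K θ₀ B₀ δ₀ a₁ M₁ ML c35Y_pos hα hα2 hN hN' hCℓ hK hB₀ hδ₀ ha₁ hM₁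
      hst hκ h261 h36)
  exact hE37

/-- **The same at the LITERAL PIN `(ops x).E37 = E37OfOps (𝔴 x) (𝔬 x) (R x) (H x) (const37 …) ((1 − 2α)δ₀)`** (seat n06-c's candidate reading of `Y.E37`; its
convergence predicate IS `Conv342`, `B9Thm37Whole.converges_E37OfOps`). [cite: Balaban1985BackgroundPropagators, Thm 3.7 (3.90) pp.409–410, Cor. 3.6 p.408] -/
theorem thm37_obligation_of_local342_E37OfOps
    [∀ x : MemberY θ₃.d₆ θ₃.ℓ₆ θ₃.hd' θ₃.hL' θ₃.b₀ θ₃.b₁ Mstar, Fintype (geo9Y x).Site]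
    [∀ x : MemberY θ₃.d₆ θ₃.ℓ₆ θ₃.hd' θ₃.hL' θ₃.b₀ θ₃.b₁ Mstar, DecidableEq (geo9Y x).Site]
    {X Y ι : MemberY θ₃.d₆ θ₃.ℓ₆ θ₃.hd' θ₃.hL' θ₃.b₀ θ₃.b₁ Mstar → Type}
    [∀ x, Fintype (X x)] [∀ x, DecidableEq (X x)] [∀ x, Fintype (Y x)] [∀ x, DecidableEq (Y x)] [∀ x, Fintype (ι x)]
    (𝔴 : ∀ x : MemberY θ₃.d₆ θ₃.ℓ₆ θ₃.hd' θ₃.hL' θ₃.b₀ θ₃.b₁ Mstar, B9.RWExpansion (geo9Y x) (bg9Y (Matrix (Fin N) (Fin N) ℂ) (specialUnitaryUnits (Fin N)) x))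
    (𝔬 : ∀ x, Ops (geo9Y x) (bg9Y (Matrix (Fin N) (Fin N) ℂ) (specialUnitaryUnits (Fin N)) x) (X x) (Y x) (ι x))
    (R : MemberY θ₃.d₆ θ₃.ℓ₆ θ₃.hd' θ₃.hL' θ₃.b₀ θ₃.b₁ Mstar → ℝ) (H : MemberY θ₃.d₆ θ₃.ℓ₆ θ₃.hd' θ₃.hL' θ₃.b₀ θ₃.b₁ Mstar → Prop)
    (κ : MemberY θ₃.d₆ θ₃.ℓ₆ θ₃.hd' θ₃.hL' θ₃.b₀ θ₃.b₁ Mstar → Sizes) (d : ℕ) (α ρ Nc N' Cℓ K θ₀ B₀ δ₀ a₁ M₁ ML : ℝ)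
    (hα : 0 ≤ α) (hα2 : α ≤ 1 / 2) (hN : 0 ≤ Nc) (hN' : 0 ≤ N') (hCℓ : 1 ≤ Cℓ) (hK : 0 ≤ K) (hB₀ : 0 ≤ B₀) (hδ₀ : 0 ≤ δ₀) (ha₁ : 0 < a₁) (hM₁ : 0 < M₁)
    (hst : ∀ x, StaticOK (𝔬 x) ρ Nc N' Cℓ (κ x)) (hκ : ∀ x, (κ x).Bounded K θ₀ Cℓ (geo9Y x).M)
    (h261 : ∀ x, ML ≤ (geo9Y x).M → Ineq261 d (toB6 (geo9Y x) (R x) (H x)) δ₀ α)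
    (h36 : ∀ x, M₁ ≤ (geo9Y x).M → ∀ α₀ : ℝ, 0 < α₀ → c35Y * (geo9Y x).M * α₀ ≤ a₁ →
      ∀ U : (bg9Y (Matrix (Fin N) (Fin N) ℂ) (specialUnitaryUnits (Fin N)) x).Cfg,
        (bg9Y (Matrix (Fin N) (Fin N) ℂ) (specialUnitaryUnits (Fin N)) x).Reg335 c35Y α₀ U →
          Local342 (𝔬 x) (R x) (H x) B₀ δ₀ U ∧ Identities (𝔬 x) (R x) (H x) U)
    (hE37 : ∀ x, (ops x).E37 = E37OfOps (𝔴 x) (𝔬 x) (R x) (H x) (const37 d δ₀ α ρ B₀ Nc N' Cℓ K) ((1 - 2 * α) * δ₀)) :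
    B9.Thm37Printed c35Y geo9Y (bg9Y (Matrix (Fin N) (Fin N) ℂ) (specialUnitaryUnits (Fin N))) (fun x => (ops x).E37) :=
  thm37_obligation_of_local342 θ₃ Mstar ops 𝔬 R H κ d α ρ Nc N' Cℓ K θ₀ B₀ δ₀ a₁ M₁ ML hα hα2 hN hN' hCℓ hK hB₀ hδ₀ ha₁ hM₁ hst hκ h261 h36
    (fun x U h => by rw [hE37 x]; exact h)

/-! ## §2 the (3.42) half of the summation leaf `hsum` AT THE RECORD, from the co-readings -/

/-- **THE FOUR (3.42) CLAUSES FOR THE LAYER'S KERNEL FAMILY `(ops x).Gp` AT ONE MEMBER AND ONE U, from (3.42)-convergence of the sum and the co-readings** (n06-c's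
`clause342_of_thm37Printed` mechanism, at the record's bundle and WITHOUT provisos): if the four model operators G′(U), ∇_UG′(U), G′(U)∇*_U, Δ_UG′(U) of `𝔬 x` CO-READ the
observation quantities e₀, …, e₃ of `(ops x).Gp` (`CoRealizes`: e_n is the printed sup over the block, (3.39) ∕ (3.42) p. 397), then `Conv342 (𝔬 x) (R x) (H x) C δ U`
gives `Clause342 ((ops x).Gp) n C δ U` for every `n : Fin 4` — the sign fact `L^jη ≥ 0` DISCHARGED on the record's k-level geometry (`B6KLevelCensusIndexV1.len_pos`).
[cite: Balaban1985BackgroundPropagators, (3.42) p.397, Thm 3.7 ⇒ Thm 3.1 p.410] -/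
theorem clause342_Gp_of_conv342 [∀ x : MemberY θ₃.d₆ θ₃.ℓ₆ θ₃.hd' θ₃.hL' θ₃.b₀ θ₃.b₁ Mstar, Fintype (geo9Y x).Site]
    {X Y ι : MemberY θ₃.d₆ θ₃.ℓ₆ θ₃.hd' θ₃.hL' θ₃.b₀ θ₃.b₁ Mstar → Type}
    (𝔬 : ∀ x, Ops (geo9Y x) (bg9Y (Matrix (Fin N) (Fin N) ℂ) (specialUnitaryUnits (Fin N)) x) (X x) (Y x) (ι x))
    (R : MemberY θ₃.d₆ θ₃.ℓ₆ θ₃.hd' θ₃.hL' θ₃.b₀ θ₃.b₁ Mstar → ℝ) (H : MemberY θ₃.d₆ θ₃.ℓ₆ θ₃.hd' θ₃.hL' θ₃.b₀ θ₃.b₁ Mstar → Prop) {C δ : ℝ} (hC : 0 ≤ C)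
    (ev : ∀ x : MemberY θ₃.d₆ θ₃.ℓ₆ θ₃.hd' θ₃.hL' θ₃.b₀ θ₃.b₁ Mstar, (geo9Y x).Loc → X x → ℝ)
    (evY : ∀ x : MemberY θ₃.d₆ θ₃.ℓ₆ θ₃.hd' θ₃.hL' θ₃.b₀ θ₃.b₁ Mstar, (geo9Y x).Loc → Y x → ℝ)
    (hco0 : ∀ x U, CoRealizes (ops x).Gp 0 U (𝔬 x).blk (𝔬 x).blk (ev x) ((𝔬 x).Gp U))
    (hco1 : ∀ x U, CoRealizes (ops x).Gp 1 U (𝔬 x).blkY (𝔬 x).blk (ev x) ((𝔬 x).D U ∘ₗ (𝔬 x).Gp U))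
    (hco2 : ∀ x U, CoRealizes (ops x).Gp 2 U (𝔬 x).blk (𝔬 x).blkY (evY x) ((𝔬 x).Gp U ∘ₗ (𝔬 x).Dstar U))
    (hco3 : ∀ x U, CoRealizes (ops x).Gp 3 U (𝔬 x).blk (𝔬 x).blk (ev x) ((𝔬 x).Lap U ∘ₗ (𝔬 x).Gp U))
    (x : MemberY θ₃.d₆ θ₃.ℓ₆ θ₃.hd' θ₃.hL' θ₃.b₀ θ₃.b₁ Mstar) (U : (bg9Y (Matrix (Fin N) (Fin N) ℂ) (specialUnitaryUnits (Fin N)) x).Cfg)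
    (hconv : Conv342 (𝔬 x) (R x) (H x) C δ U) (n : Fin 4) : Clause342 (ops x).Gp n C δ U := by
  have hlen : ∀ y : (geo9Y x).Site, 0 ≤ (geo9Y x).len y := fun y => (len_pos x.toKIdx y).le
  obtain ⟨h0, h1, h2, h3⟩ := hconv
  exact clause342_all (clause342_e0_of_hasMajorant (hco0 x U) h0 hC hlen) (clause342_e1_of_hasMajorantHom (hco1 x U) h1 hC hlen)
    (clause342_e2_of_hasMajorantHom (hco2 x U) h2 hC hlen) (clause342_e3_of_hasMajorantHom (hco3 x U) h3 hC hlen) n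

/-- **Merging constants AT THE RECORD'S GEOMETRY**: a (3.42) clause for a kernel family on `geo9Y x` with constants `(C, δ′)`, `0 ≤ C ≤ B₀`, `δ₀ ≤ δ′`, is the clause
with `(B₀, δ₀)` — the three sign facts `d ≥ 0`, `L^jη ≥ 0`, `|λ| ≥ 0` of `clause342_mono` DISCHARGED on the genuine lattice norms (3.39)–(3.41) of the member
(`geo9K_dist_nonneg`, `len_pos`, `geo9K_supNorm_nonneg`). [cite: Balaban1985BackgroundPropagators, (3.42) p.397, (3.39)–(3.41) p.397] -/
theorem clause342_Gp_mono_pin (x : MemberY θ₃.d₆ θ₃.ℓ₆ θ₃.hd' θ₃.hL' θ₃.b₀ θ₃.b₁ Mstar)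
    {K : B9.KernelFamily (geo9Y x) (bg9Y (Matrix (Fin N) (Fin N) ℂ) (specialUnitaryUnits (Fin N)) x)} {n : Fin 4} {C δ' B₀ δ₀ : ℝ}
    {U : (bg9Y (Matrix (Fin N) (Fin N) ℂ) (specialUnitaryUnits (Fin N)) x).Cfg} (h : Clause342 K n C δ' U) (hC : 0 ≤ C) (hCB : C ≤ B₀) (hδ : δ₀ ≤ δ') :
    Clause342 K n B₀ δ₀ U :=
  clause342_mono h hC hCB hδ (geo9K_dist_nonneg x.toKIdx) (fun y => (len_pos x.toKIdx y).le) (geo9K_supNorm_nonneg x.toKIdx)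

/-- **THE SUMMATION LEAF `hsum` AT THE RECORD FROM THE CO-READINGS AND THE DISPLAYED RESIDUAL** (p. 410: «Theorem 3.7 implies that all the inequalities (3.42)–(3.47) hold
for G′»; p. 416 for G).  Under the converse half of the pinned reading — «`(ops x).E37` converges at U ⇒ the sum obeys the four (3.42) majorants with `(C, δ)`» — and the
four co-readings, `B9.RWSumsYieldIneqs geo9Y bg9Y E37 E310 Gp GA` holds with constants `(B₀, δ₀, B₀(·), B′₀(·), B′₀(·,·))`, `0 < B₀`, `0 < δ₀ ≤ δ`, `C ≤ B₀`, from: the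
residual of the G′-clause — (3.46), (3.47) and the Hölder block (3.43)–(3.45) for `(ops x).Gp` given convergence — and the whole G-clause for `(ops x).E310` ∕ `(ops x).GA`,
DISPLAYED; the (3.42) block of the G′-clause is §2's theorem.  The residual is by reference in print (GAPS G-B9-07) — NOT proved here.
[cite: Balaban1985BackgroundPropagators, Thm 3.7 ⇒ Thm 3.1 p.410, (3.42)–(3.47) pp.397–398, Thm 3.10 ⇒ Thm 3.3 p.416] -/
theorem rwSumsYieldIneqs_of_conv342_pin [∀ x : MemberY θ₃.d₆ θ₃.ℓ₆ θ₃.hd' θ₃.hL' θ₃.b₀ θ₃.b₁ Mstar, Fintype (geo9Y x).Site]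
    {X Y ι : MemberY θ₃.d₆ θ₃.ℓ₆ θ₃.hd' θ₃.hL' θ₃.b₀ θ₃.b₁ Mstar → Type}
    (𝔬 : ∀ x, Ops (geo9Y x) (bg9Y (Matrix (Fin N) (Fin N) ℂ) (specialUnitaryUnits (Fin N)) x) (X x) (Y x) (ι x))
    (R : MemberY θ₃.d₆ θ₃.ℓ₆ θ₃.hd' θ₃.hL' θ₃.b₀ θ₃.b₁ Mstar → ℝ) (H : MemberY θ₃.d₆ θ₃.ℓ₆ θ₃.hd' θ₃.hL' θ₃.b₀ θ₃.b₁ Mstar → Prop) {C δ : ℝ} (hC : 0 ≤ C)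
    (ev : ∀ x : MemberY θ₃.d₆ θ₃.ℓ₆ θ₃.hd' θ₃.hL' θ₃.b₀ θ₃.b₁ Mstar, (geo9Y x).Loc → X x → ℝ)
    (evY : ∀ x : MemberY θ₃.d₆ θ₃.ℓ₆ θ₃.hd' θ₃.hL' θ₃.b₀ θ₃.b₁ Mstar, (geo9Y x).Loc → Y x → ℝ)
    (hco0 : ∀ x U, CoRealizes (ops x).Gp 0 U (𝔬 x).blk (𝔬 x).blk (ev x) ((𝔬 x).Gp U))
    (hco1 : ∀ x U, CoRealizes (ops x).Gp 1 U (𝔬 x).blkY (𝔬 x).blk (ev x) ((𝔬 x).D U ∘ₗ (𝔬 x).Gp U))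
    (hco2 : ∀ x U, CoRealizes (ops x).Gp 2 U (𝔬 x).blk (𝔬 x).blkY (evY x) ((𝔬 x).Gp U ∘ₗ (𝔬 x).Dstar U))
    (hco3 : ∀ x U, CoRealizes (ops x).Gp 3 U (𝔬 x).blk (𝔬 x).blk (ev x) ((𝔬 x).Lap U ∘ₗ (𝔬 x).Gp U))
    (hE37 : ∀ (x : MemberY θ₃.d₆ θ₃.ℓ₆ θ₃.hd' θ₃.hL' θ₃.b₀ θ₃.b₁ Mstar) (U : (bg9Y (Matrix (Fin N) (Fin N) ℂ) (specialUnitaryUnits (Fin N)) x).Cfg),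
      ((ops x).E37).Converges U → Conv342 (𝔬 x) (R x) (H x) C δ U)
    {B₀ δ₀ : ℝ} (hB₀ : 0 < B₀) (hδ₀ : 0 < δ₀) (hCB : C ≤ B₀) (hδ : δ₀ ≤ δ) {Bβ Bε : ℝ → ℝ} {Bεβ : ℝ → ℝ → ℝ}
    (hrest : ∀ (x : MemberY θ₃.d₆ θ₃.ℓ₆ θ₃.hd' θ₃.hL' θ₃.b₀ θ₃.b₁ Mstar) (U : (bg9Y (Matrix (Fin N) (Fin N) ℂ) (specialUnitaryUnits (Fin N)) x).Cfg),
      ((ops x).E37).Converges U →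
        (∀ (n : Fin 6) (lam : (geo9Y x).Loc) (h : (geo9Y x).Cut) (y y' : (geo9Y x).Site), (geo9Y x).cutIn h y → (geo9Y x).suppIn lam y' →
            (ops x).Gp.l2 n U lam h ≤ B₀ * B9.pref6 ((geo9Y x).len y) n * (geo9Y x).cutSup h * Real.exp (-(δ₀ * (geo9Y x).dist y y')) * (geo9Y x).l2Norm lam) ∧
        (∀ (n : Fin 4) (lam : (geo9Y x).Loc) (γ : ℝ), -4 ≤ γ → γ ≤ 4 → (ops x).Gp.glob n U lam γ ≤ B₀ * (geo9Y x).wNorm γ lam) ∧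
        B9.Ineq343_345 (ops x).Gp Bβ Bε Bεβ δ₀ U)
    (h310 : ∀ (x : MemberY θ₃.d₆ θ₃.ℓ₆ θ₃.hd' θ₃.hL' θ₃.b₀ θ₃.b₁ Mstar) (U : (bg9Y (Matrix (Fin N) (Fin N) ℂ) (specialUnitaryUnits (Fin N)) x).Cfg),
      ((ops x).E310).Converges U → B9.Ineq342_346_347 (ops x).GA B₀ δ₀ U ∧ B9.Ineq343_345 (ops x).GA Bβ Bε Bεβ δ₀ U) :
    B9.RWSumsYieldIneqs geo9Y (bg9Y (Matrix (Fin N) (Fin N) ℂ) (specialUnitaryUnits (Fin N))) (fun x => (ops x).E37) (fun x => (ops x).E310)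
      (fun x => (ops x).Gp) (fun x => (ops x).GA) := by
  refine ⟨B₀, δ₀, Bβ, Bε, Bεβ, hB₀, hδ₀, fun x U => ⟨fun hconv => ?_, h310 x U⟩⟩
  obtain ⟨h346, h347, hH⟩ := hrest x U hconv
  refine ⟨ineq342_346_347_of_clauses (fun n => ?_) h346 h347, hH⟩
  exact clause342_Gp_mono_pin θ₃ Mstar x (clause342_Gp_of_conv342 θ₃ Mstar ops 𝔬 R H hC ev evY hco0 hco1 hco2 hco3 x U (hE37 x U hconv) n) hC hCB hδ

end AtBundle

/-! ## §3 THE KNIT AT ₁₁ with `t37` (and the (3.42) half of `hsum`) SUPPLIED -/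

section Pointed

variable [NeZero N] {F : T4Family}

/-- **THE ₁₁ CERTIFICATE WITH ITS `t37` LEAF SUPPLIED BY n06-c's GLUE.**  `Dag.B9_main` at every run of a world bound over the four-pin Stage-11 view of the package
`(θ, M⋆, ops, ζ, λ_W)` FROM: the other 27 obligations of `N06AtRecord11CB10YZW.b9_main_of_up_view₁₁B10YZW_of_obligations` verbatim, PLUS — in place of
`t37 : B9.Thm37Printed …` — an `Ops` record `𝔬` of model operators at every member with n06-c's five printed-shape schemas and the pinned convergence reading of the
layer's Theorem-3.7 letter (§1 `thm37_obligation_of_local342`).  Displayed and nothing else; NOT a discharge of N06.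
[cite: Balaban1985BackgroundPropagators, Thms 3.1–3.15 pp.397–432; Thm 3.7 (3.90) pp.409–410, Cor. 3.6 p.408, Sect. A (3.35) p.396, (3.39)–(3.41) p.397; Balaban1984PropagatorsII, Lemma 2.1 (2.61) p.234, Props. 2.2–2.7 pp.234–249] -/
theorem b9_main_of_up_view₁₁B10YZW_of_obligations_t37supplied (θ : Stage11Params F N) (hθ : θ.Admissible) (Mstar : ℕ) (ops : OpsY N θ.toStage3Params Mstar)
    (ζ : ResidZ F N) (lamW : ResidW F N) (w : WorldP) (hup : ∀ P, w.up P = upOfRecord₅C F N (θ.view₁₁B10YZW F N Mstar ops ζ lamW) P)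
    (hGp_e : ∀ (x : MemberY θ.d₆ θ.ℓ₆ θ.hd' θ.hL' θ.b₀ θ.b₁ Mstar) (n : Fin 4) (lam : (geo9Y x).Loc) (y : (geo9Y x).Site),
      (ops x).Gp.e n (bg9Y (Matrix (Fin N) (Fin N) ℂ) (specialUnitaryUnits (Fin N)) x).one lam y ≤ (Node00.GpU x.toKIdx).e n lam y)
    (hGp_h1 : ∀ (x : MemberY θ.d₆ θ.ℓ₆ θ.hd' θ.hL' θ.b₀ θ.b₁ Mstar) (lam : (geo9Y x).Loc) (b : ℝ) (c : (geo9Y x).Cut),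
      (ops x).Gp.h1 (bg9Y (Matrix (Fin N) (Fin N) ℂ) (specialUnitaryUnits (Fin N)) x).one lam b c ≤ (Node00.GpU x.toKIdx).h1 lam b c)
    (hC : ∀ (x : MemberY θ.d₆ θ.ℓ₆ θ.hd' θ.hL' θ.b₀ θ.b₁ Mstar) (y y' : (geo9Y x).Site),
      |(ops x).Cinv.ker (bg9Y (Matrix (Fin N) (Fin N) ℂ) (specialUnitaryUnits (Fin N)) x).one y y'| ≤ |(Node00.CinvU x.toKIdx).ker y y'|)
    (hGA_e : ∀ (x : MemberY θ.d₆ θ.ℓ₆ θ.hd' θ.hL' θ.b₀ θ.b₁ Mstar) (n : Fin 4) (lam : (geo9Y x).Loc) (y : (geo9Y x).Site),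
      (ops x).GA.e n (bg9Y (Matrix (Fin N) (Fin N) ℂ) (specialUnitaryUnits (Fin N)) x).one lam y ≤ (Node00.GU x.toKIdx).e n lam y)
    (hGA_h1 : ∀ (x : MemberY θ.d₆ θ.ℓ₆ θ.hd' θ.hL' θ.b₀ θ.b₁ Mstar) (lam : (geo9Y x).Loc) (b : ℝ) (c : (geo9Y x).Cut),
      (ops x).GA.h1 (bg9Y (Matrix (Fin N) (Fin N) ℂ) (specialUnitaryUnits (Fin N)) x).one lam b c ≤ (Node00.GU x.toKIdx).h1 lam b c)
    (hGA_e4 : ∀ (x : MemberY θ.d₆ θ.ℓ₆ θ.hd' θ.hL' θ.b₀ θ.b₁ Mstar) (lam : (geo9Y x).Loc) (y : (geo9Y x).Site),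
      (ops x).GA.e4 (bg9Y (Matrix (Fin N) (Fin N) ℂ) (specialUnitaryUnits (Fin N)) x).one lam y ≤ (Node00.GU x.toKIdx).e4 lam y)
    (hGA_h2 : ∀ (x : MemberY θ.d₆ θ.ℓ₆ θ.hd' θ.hL' θ.b₀ θ.b₁ Mstar) (lam : (geo9Y x).Loc) (b : ℝ) (c : (geo9Y x).Cut),
      (ops x).GA.h2 (bg9Y (Matrix (Fin N) (Fin N) ℂ) (specialUnitaryUnits (Fin N)) x).one lam b c ≤ (Node00.GU x.toKIdx).h2 lam b c)
    (hGA_l2 : ∀ (x : MemberY θ.d₆ θ.ℓ₆ θ.hd' θ.hL' θ.b₀ θ.b₁ Mstar) (n : Fin 6) (lam : (geo9Y x).Loc) (hc : (geo9Y x).Cut),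
      (ops x).GA.l2 n (bg9Y (Matrix (Fin N) (Fin N) ℂ) (specialUnitaryUnits (Fin N)) x).one lam hc ≤ (Node00.GU x.toKIdx).l2 n lam hc)
    (hE4 : ∀ (x : MemberY θ.d₆ θ.ℓ₆ θ.hd' θ.hL' θ.b₀ θ.b₁ Mstar) (lam : (geo9Y x).Loc), ¬ (lam.isRight = true) →
      ∀ y, (ops x).GA.e4 (bg9Y (Matrix (Fin N) (Fin N) ℂ) (specialUnitaryUnits (Fin N)) x).one lam y ≤ 0)
    (hH2 : ∀ (x : MemberY θ.d₆ θ.ℓ₆ θ.hd' θ.hL' θ.b₀ θ.b₁ Mstar) (lam : (geo9Y x).Loc), ¬ (lam.isRight = true) →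
      ∀ (β : ℝ) (c : (geo9Y x).Cut), (ops x).GA.h2 (bg9Y (Matrix (Fin N) (Fin N) ℂ) (specialUnitaryUnits (Fin N)) x).one lam β c ≤ 0)
    (hGp : B9FromB6.ResidualGpAtOne geo9Y (bg9Y (Matrix (Fin N) (Fin N) ℂ) (specialUnitaryUnits (Fin N))) (fun x => (ops x).Gp))
    (hGA : B9FromB6.ResidualGAGlobAtOne geo9Y (bg9Y (Matrix (Fin N) (Fin N) ℂ) (specialUnitaryUnits (Fin N))) (fun x => (ops x).GA))
    (hB : B9.SectBStepPrinted (θ.d₆ + 1) c35Y geo9Y (bg9Y (Matrix (Fin N) (Fin N) ℂ) (specialUnitaryUnits (Fin N))) (fun x => (ops x).Gp)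
      (fun x => (ops x).GA) (fun x => (ops x).Cinv) (fun x => (ops x).IsAnalyticExt))
    (hg : B9.GaugeReduction335 (θ.d₆ + 1) c35Y geo9Y (bg9Y (Matrix (Fin N) (Fin N) ℂ) (specialUnitaryUnits (Fin N))) InCubeY (fun x => (ops x).Gp)
      (fun x => (ops x).GA) (fun x => (ops x).Cinv))
    -- in place of `t37`: n06-c's five schemas + the pinned convergence reading (§1)
    [∀ x : MemberY θ.d₆ θ.ℓ₆ θ.hd' θ.hL' θ.b₀ θ.b₁ Mstar, Fintype (geo9Y x).Site]
    [∀ x : MemberY θ.d₆ θ.ℓ₆ θ.hd' θ.hL' θ.b₀ θ.b₁ Mstar, DecidableEq (geo9Y x).Site]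
    {X Y ι : MemberY θ.d₆ θ.ℓ₆ θ.hd' θ.hL' θ.b₀ θ.b₁ Mstar → Type}
    [∀ x, Fintype (X x)] [∀ x, DecidableEq (X x)] [∀ x, Fintype (Y x)] [∀ x, DecidableEq (Y x)] [∀ x, Fintype (ι x)]
    (𝔬 : ∀ x, Ops (geo9Y x) (bg9Y (Matrix (Fin N) (Fin N) ℂ) (specialUnitaryUnits (Fin N)) x) (X x) (Y x) (ι x))
    (R : MemberY θ.d₆ θ.ℓ₆ θ.hd' θ.hL' θ.b₀ θ.b₁ Mstar → ℝ) (H : MemberY θ.d₆ θ.ℓ₆ θ.hd' θ.hL' θ.b₀ θ.b₁ Mstar → Prop)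
    (κ : MemberY θ.d₆ θ.ℓ₆ θ.hd' θ.hL' θ.b₀ θ.b₁ Mstar → Sizes) (d : ℕ) (α ρ Nc N' Cℓ K θ₀ B₀ δ₀ a₁ M₁ ML : ℝ)
    (hα : 0 ≤ α) (hα2 : α ≤ 1 / 2) (hN : 0 ≤ Nc) (hN' : 0 ≤ N') (hCℓ : 1 ≤ Cℓ) (hK : 0 ≤ K) (hB₀ : 0 ≤ B₀) (hδ₀ : 0 ≤ δ₀) (ha₁ : 0 < a₁) (hM₁ : 0 < M₁)
    (hst : ∀ x, StaticOK (𝔬 x) ρ Nc N' Cℓ (κ x)) (hκ : ∀ x, (κ x).Bounded K θ₀ Cℓ (geo9Y x).M)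
    (h261 : ∀ x, ML ≤ (geo9Y x).M → Ineq261 d (toB6 (geo9Y x) (R x) (H x)) δ₀ α)
    (h36 : ∀ x, M₁ ≤ (geo9Y x).M → ∀ α₀ : ℝ, 0 < α₀ → c35Y * (geo9Y x).M * α₀ ≤ a₁ →
      ∀ U : (bg9Y (Matrix (Fin N) (Fin N) ℂ) (specialUnitaryUnits (Fin N)) x).Cfg,
        (bg9Y (Matrix (Fin N) (Fin N) ℂ) (specialUnitaryUnits (Fin N)) x).Reg335 c35Y α₀ U →
          Local342 (𝔬 x) (R x) (H x) B₀ δ₀ U ∧ Identities (𝔬 x) (R x) (H x) U)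
    (hE37 : ∀ (x : MemberY θ.d₆ θ.ℓ₆ θ.hd' θ.hL' θ.b₀ θ.b₁ Mstar) (U : (bg9Y (Matrix (Fin N) (Fin N) ℂ) (specialUnitaryUnits (Fin N)) x).Cfg),
      Conv342 (𝔬 x) (R x) (H x) (const37 d δ₀ α ρ B₀ Nc N' Cℓ K) ((1 - 2 * α) * δ₀) U → ((ops x).E37).Converges U)
    -- the remaining printed leaves, verbatim
    (c38 : B9.Cor38Printed c35Y geo9Y (bg9Y (Matrix (Fin N) (Fin N) ℂ) (specialUnitaryUnits (Fin N))) (fun x => (ops x).E37))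
    (t39 : B9.Thm39Printed (θ.d₆ + 1) c35Y geo9Y (bg9Y (Matrix (Fin N) (Fin N) ℂ) (specialUnitaryUnits (Fin N))) (fun x => (ops x).EK39))
    (t310 : B9.Thm310Printed c35Y geo9Y (bg9Y (Matrix (Fin N) (Fin N) ℂ) (specialUnitaryUnits (Fin N))) (fun x => (ops x).E310))
    (hsum : B9.RWSumsYieldIneqs geo9Y (bg9Y (Matrix (Fin N) (Fin N) ℂ) (specialUnitaryUnits (Fin N))) (fun x => (ops x).E37) (fun x => (ops x).E310)
      (fun x => (ops x).Gp) (fun x => (ops x).GA))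
    (hksum : B9.RWKernelSumYields (θ.d₆ + 1) geo9Y (bg9Y (Matrix (Fin N) (Fin N) ℂ) (specialUnitaryUnits (Fin N))) (fun x => (ops x).EK39)
      (fun x => (ops x).Cinv))
    (t311 : B9.Thm311Printed c35Y geo9Y (bg9Y (Matrix (Fin N) (Fin N) ℂ) (specialUnitaryUnits (Fin N))) (fun x => (ops x).PosDef))
    (t312 : B9.Thm312Printed (θ.d₆ + 1) c35Y geo9Y (bg9Y (Matrix (Fin N) (Fin N) ℂ) (specialUnitaryUnits (Fin N))) (fun x => (ops x).GD)
      (fun x => (ops x).G₁) (fun x => (ops x).H) (fun x => (ops x).H₁) (fun x => (ops x).HasRWExp) (fun x => (ops x).HasRWExpH)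
      (fun x => (ops x).PosDefK))
    (t313 : B9.Thm313Printed c35Y geo9Y (bg9Y (Matrix (Fin N) (Fin N) ℂ) (specialUnitaryUnits (Fin N))) (fun x => (ops x).GG)
      (fun x => (ops x).HasRWExp) (fun x => (ops x).PosDefK))
    (t314 : B9.Thm314Printed c35Y geo9Y (bg9Y (Matrix (Fin N) (Fin N) ℂ) (specialUnitaryUnits (Fin N))) (fun x => (ops x).Kdiff) dOmegaY)
    (t315 : B9.Thm315FullPrinted c35Y geo9Y (bg9Y (Matrix (Fin N) (Fin N) ℂ) (specialUnitaryUnits (Fin N))) (fun x => (ops x).Ck) inΛY unitDistY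
      (fun x => (ops x).GivenBy3185) (fun x => (ops x).HasRWExpC))
    (s349 : B9.Stmt349Printed (θ.d₆ + 1) c35Y geo9Y (bg9Y (Matrix (Fin N) (Fin N) ℂ) (specialUnitaryUnits (Fin N))) (fun x => (ops x).P349))
    (s3132 : B9.Stmt3132Printed (θ.d₆ + 1) c35Y geo9Y (bg9Y (Matrix (Fin N) (Fin N) ℂ) (specialUnitaryUnits (Fin N))) (fun x => (ops x).QGQinv)
      (fun x => (ops x).QG1Qinv))
    (t314loc : B9Thm314.Thm314LocalPrinted c35Y geo9Y (bg9Y (Matrix (Fin N) (Fin N) ℂ) (specialUnitaryUnits (Fin N))) (fun x => (ops x).Kdiff)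
      OmKY dOmegaY)
    (P : B12.RunParams) : Dag.B9_main (leavesP w P) :=
  N06AtRecord11CB10YZW.b9_main_of_up_view₁₁B10YZW_of_obligations θ hθ Mstar ops ζ lamW w hup hGp_e hGp_h1 hC hGA_e hGA_h1 hGA_e4 hGA_h2 hGA_l2 hE4 hH2
    hGp hGA hB hg
    (thm37_obligation_of_local342 θ.toStage3Params Mstar ops 𝔬 R H κ d α ρ Nc N' Cℓ K θ₀ B₀ δ₀ a₁ M₁ ML hα hα2 hN hN' hCℓ hK hB₀ hδ₀ ha₁ hM₁ hst hκ
      h261 h36 hE37)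
    c38 t39 t310 hsum hksum t311 t312 t313 t314 t315 s349 s3132 t314loc P

/-- **THE ₁₁ CERTIFICATE WITH `t37` AND THE (3.42) HALF OF `hsum` SUPPLIED.**  As `…_t37supplied`, with the pinned reading an `iff` («`(ops x).E37` converges at U ⟺
the sum (3.90) obeys the four (3.42) majorants with `(const37 …, (1 − 2α)δ₀)`» — `E37OfOps` ∕ `W38OfOps` satisfy it by `Iff.rfl`) and — in place of `hsum` — the four
co-readings of `(ops x).Gp` by `𝔬 x`'s model operators, constants `0 < B₁` with `const37 … ≤ B₁`, `0 < δ₁ ≤ (1 − 2α)δ₀`, and the DISPLAYED residual of the summation leaf: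
(3.46) + (3.47) + the Hölder block for `Gp` given convergence, the whole G-clause for `E310` ∕ `GA` (§2 `rwSumsYieldIneqs_of_conv342_pin`).  26 operator-layer obligations +
5 schemas + 4 co-readings + the residual, displayed and nothing else; NOT a discharge of N06.
[cite: Balaban1985BackgroundPropagators, Thms 3.1–3.15 pp.397–432; Thm 3.7 ⇒ Thm 3.1 p.410, (3.42)–(3.47) pp.397–398, Cor. 3.6 p.408, (3.35) p.396; Balaban1984PropagatorsII, Lemma 2.1 (2.61) p.234, Props. 2.2–2.7 pp.234–249] -/
theorem b9_main_of_up_view₁₁B10YZW_of_obligations_t37hsum342supplied (θ : Stage11Params F N) (hθ : θ.Admissible) (Mstar : ℕ)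
    (ops : OpsY N θ.toStage3Params Mstar) (ζ : ResidZ F N) (lamW : ResidW F N) (w : WorldP)
    (hup : ∀ P, w.up P = upOfRecord₅C F N (θ.view₁₁B10YZW F N Mstar ops ζ lamW) P)
    (hGp_e : ∀ (x : MemberY θ.d₆ θ.ℓ₆ θ.hd' θ.hL' θ.b₀ θ.b₁ Mstar) (n : Fin 4) (lam : (geo9Y x).Loc) (y : (geo9Y x).Site),
      (ops x).Gp.e n (bg9Y (Matrix (Fin N) (Fin N) ℂ) (specialUnitaryUnits (Fin N)) x).one lam y ≤ (Node00.GpU x.toKIdx).e n lam y)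
    (hGp_h1 : ∀ (x : MemberY θ.d₆ θ.ℓ₆ θ.hd' θ.hL' θ.b₀ θ.b₁ Mstar) (lam : (geo9Y x).Loc) (b : ℝ) (c : (geo9Y x).Cut),
      (ops x).Gp.h1 (bg9Y (Matrix (Fin N) (Fin N) ℂ) (specialUnitaryUnits (Fin N)) x).one lam b c ≤ (Node00.GpU x.toKIdx).h1 lam b c)
    (hC : ∀ (x : MemberY θ.d₆ θ.ℓ₆ θ.hd' θ.hL' θ.b₀ θ.b₁ Mstar) (y y' : (geo9Y x).Site),
      |(ops x).Cinv.ker (bg9Y (Matrix (Fin N) (Fin N) ℂ) (specialUnitaryUnits (Fin N)) x).one y y'| ≤ |(Node00.CinvU x.toKIdx).ker y y'|)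
    (hGA_e : ∀ (x : MemberY θ.d₆ θ.ℓ₆ θ.hd' θ.hL' θ.b₀ θ.b₁ Mstar) (n : Fin 4) (lam : (geo9Y x).Loc) (y : (geo9Y x).Site),
      (ops x).GA.e n (bg9Y (Matrix (Fin N) (Fin N) ℂ) (specialUnitaryUnits (Fin N)) x).one lam y ≤ (Node00.GU x.toKIdx).e n lam y)
    (hGA_h1 : ∀ (x : MemberY θ.d₆ θ.ℓ₆ θ.hd' θ.hL' θ.b₀ θ.b₁ Mstar) (lam : (geo9Y x).Loc) (b : ℝ) (c : (geo9Y x).Cut),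
      (ops x).GA.h1 (bg9Y (Matrix (Fin N) (Fin N) ℂ) (specialUnitaryUnits (Fin N)) x).one lam b c ≤ (Node00.GU x.toKIdx).h1 lam b c)
    (hGA_e4 : ∀ (x : MemberY θ.d₆ θ.ℓ₆ θ.hd' θ.hL' θ.b₀ θ.b₁ Mstar) (lam : (geo9Y x).Loc) (y : (geo9Y x).Site),
      (ops x).GA.e4 (bg9Y (Matrix (Fin N) (Fin N) ℂ) (specialUnitaryUnits (Fin N)) x).one lam y ≤ (Node00.GU x.toKIdx).e4 lam y)
    (hGA_h2 : ∀ (x : MemberY θ.d₆ θ.ℓ₆ θ.hd' θ.hL' θ.b₀ θ.b₁ Mstar) (lam : (geo9Y x).Loc) (b : ℝ) (c : (geo9Y x).Cut),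
      (ops x).GA.h2 (bg9Y (Matrix (Fin N) (Fin N) ℂ) (specialUnitaryUnits (Fin N)) x).one lam b c ≤ (Node00.GU x.toKIdx).h2 lam b c)
    (hGA_l2 : ∀ (x : MemberY θ.d₆ θ.ℓ₆ θ.hd' θ.hL' θ.b₀ θ.b₁ Mstar) (n : Fin 6) (lam : (geo9Y x).Loc) (hc : (geo9Y x).Cut),
      (ops x).GA.l2 n (bg9Y (Matrix (Fin N) (Fin N) ℂ) (specialUnitaryUnits (Fin N)) x).one lam hc ≤ (Node00.GU x.toKIdx).l2 n lam hc)
    (hE4 : ∀ (x : MemberY θ.d₆ θ.ℓ₆ θ.hd' θ.hL' θ.b₀ θ.b₁ Mstar) (lam : (geo9Y x).Loc), ¬ (lam.isRight = true) →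
      ∀ y, (ops x).GA.e4 (bg9Y (Matrix (Fin N) (Fin N) ℂ) (specialUnitaryUnits (Fin N)) x).one lam y ≤ 0)
    (hH2 : ∀ (x : MemberY θ.d₆ θ.ℓ₆ θ.hd' θ.hL' θ.b₀ θ.b₁ Mstar) (lam : (geo9Y x).Loc), ¬ (lam.isRight = true) →
      ∀ (β : ℝ) (c : (geo9Y x).Cut), (ops x).GA.h2 (bg9Y (Matrix (Fin N) (Fin N) ℂ) (specialUnitaryUnits (Fin N)) x).one lam β c ≤ 0)
    (hGp : B9FromB6.ResidualGpAtOne geo9Y (bg9Y (Matrix (Fin N) (Fin N) ℂ) (specialUnitaryUnits (Fin N))) (fun x => (ops x).Gp))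
    (hGA : B9FromB6.ResidualGAGlobAtOne geo9Y (bg9Y (Matrix (Fin N) (Fin N) ℂ) (specialUnitaryUnits (Fin N))) (fun x => (ops x).GA))
    (hB : B9.SectBStepPrinted (θ.d₆ + 1) c35Y geo9Y (bg9Y (Matrix (Fin N) (Fin N) ℂ) (specialUnitaryUnits (Fin N))) (fun x => (ops x).Gp)
      (fun x => (ops x).GA) (fun x => (ops x).Cinv) (fun x => (ops x).IsAnalyticExt))
    (hg : B9.GaugeReduction335 (θ.d₆ + 1) c35Y geo9Y (bg9Y (Matrix (Fin N) (Fin N) ℂ) (specialUnitaryUnits (Fin N))) InCubeY (fun x => (ops x).Gp)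
      (fun x => (ops x).GA) (fun x => (ops x).Cinv))
    -- in place of `t37` and `hsum`: n06-c's five schemas, the pinned reading as an `iff`, the four co-readings, the residual of the summation leaf
    [∀ x : MemberY θ.d₆ θ.ℓ₆ θ.hd' θ.hL' θ.b₀ θ.b₁ Mstar, Fintype (geo9Y x).Site]
    [∀ x : MemberY θ.d₆ θ.ℓ₆ θ.hd' θ.hL' θ.b₀ θ.b₁ Mstar, DecidableEq (geo9Y x).Site]
    {X Y ι : MemberY θ.d₆ θ.ℓ₆ θ.hd' θ.hL' θ.b₀ θ.b₁ Mstar → Type}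
    [∀ x, Fintype (X x)] [∀ x, DecidableEq (X x)] [∀ x, Fintype (Y x)] [∀ x, DecidableEq (Y x)] [∀ x, Fintype (ι x)]
    (𝔬 : ∀ x, Ops (geo9Y x) (bg9Y (Matrix (Fin N) (Fin N) ℂ) (specialUnitaryUnits (Fin N)) x) (X x) (Y x) (ι x))
    (R : MemberY θ.d₆ θ.ℓ₆ θ.hd' θ.hL' θ.b₀ θ.b₁ Mstar → ℝ) (H : MemberY θ.d₆ θ.ℓ₆ θ.hd' θ.hL' θ.b₀ θ.b₁ Mstar → Prop)
    (κ : MemberY θ.d₆ θ.ℓ₆ θ.hd' θ.hL' θ.b₀ θ.b₁ Mstar → Sizes) (d : ℕ) (α ρ Nc N' Cℓ K θ₀ B₀ δ₀ a₁ M₁ ML : ℝ)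
    (hα : 0 ≤ α) (hα2 : α ≤ 1 / 2) (hN : 0 ≤ Nc) (hN' : 0 ≤ N') (hCℓ : 1 ≤ Cℓ) (hK : 0 ≤ K) (hB₀ : 0 ≤ B₀) (hδ₀ : 0 ≤ δ₀) (ha₁ : 0 < a₁) (hM₁ : 0 < M₁)
    (hst : ∀ x, StaticOK (𝔬 x) ρ Nc N' Cℓ (κ x)) (hκ : ∀ x, (κ x).Bounded K θ₀ Cℓ (geo9Y x).M)
    (h261 : ∀ x, ML ≤ (geo9Y x).M → Ineq261 d (toB6 (geo9Y x) (R x) (H x)) δ₀ α)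
    (h36 : ∀ x, M₁ ≤ (geo9Y x).M → ∀ α₀ : ℝ, 0 < α₀ → c35Y * (geo9Y x).M * α₀ ≤ a₁ →
      ∀ U : (bg9Y (Matrix (Fin N) (Fin N) ℂ) (specialUnitaryUnits (Fin N)) x).Cfg,
        (bg9Y (Matrix (Fin N) (Fin N) ℂ) (specialUnitaryUnits (Fin N)) x).Reg335 c35Y α₀ U →
          Local342 (𝔬 x) (R x) (H x) B₀ δ₀ U ∧ Identities (𝔬 x) (R x) (H x) U)
    (hE37 : ∀ (x : MemberY θ.d₆ θ.ℓ₆ θ.hd' θ.hL' θ.b₀ θ.b₁ Mstar) (U : (bg9Y (Matrix (Fin N) (Fin N) ℂ) (specialUnitaryUnits (Fin N)) x).Cfg),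
      ((ops x).E37).Converges U ↔ Conv342 (𝔬 x) (R x) (H x) (const37 d δ₀ α ρ B₀ Nc N' Cℓ K) ((1 - 2 * α) * δ₀) U)
    (ev : ∀ x : MemberY θ.d₆ θ.ℓ₆ θ.hd' θ.hL' θ.b₀ θ.b₁ Mstar, (geo9Y x).Loc → X x → ℝ)
    (evY : ∀ x : MemberY θ.d₆ θ.ℓ₆ θ.hd' θ.hL' θ.b₀ θ.b₁ Mstar, (geo9Y x).Loc → Y x → ℝ)
    (hco0 : ∀ x U, CoRealizes (ops x).Gp 0 U (𝔬 x).blk (𝔬 x).blk (ev x) ((𝔬 x).Gp U))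
    (hco1 : ∀ x U, CoRealizes (ops x).Gp 1 U (𝔬 x).blkY (𝔬 x).blk (ev x) ((𝔬 x).D U ∘ₗ (𝔬 x).Gp U))
    (hco2 : ∀ x U, CoRealizes (ops x).Gp 2 U (𝔬 x).blk (𝔬 x).blkY (evY x) ((𝔬 x).Gp U ∘ₗ (𝔬 x).Dstar U))
    (hco3 : ∀ x U, CoRealizes (ops x).Gp 3 U (𝔬 x).blk (𝔬 x).blk (ev x) ((𝔬 x).Lap U ∘ₗ (𝔬 x).Gp U))
    {B₁ δ₁ : ℝ} (hB₁ : 0 < B₁) (hδ₁ : 0 < δ₁) (hCB : const37 d δ₀ α ρ B₀ Nc N' Cℓ K ≤ B₁) (hδ₁le : δ₁ ≤ (1 - 2 * α) * δ₀)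
    {Bβ Bε : ℝ → ℝ} {Bεβ : ℝ → ℝ → ℝ}
    (hrest : ∀ (x : MemberY θ.d₆ θ.ℓ₆ θ.hd' θ.hL' θ.b₀ θ.b₁ Mstar) (U : (bg9Y (Matrix (Fin N) (Fin N) ℂ) (specialUnitaryUnits (Fin N)) x).Cfg),
      ((ops x).E37).Converges U →
        (∀ (n : Fin 6) (lam : (geo9Y x).Loc) (h : (geo9Y x).Cut) (y y' : (geo9Y x).Site), (geo9Y x).cutIn h y → (geo9Y x).suppIn lam y' →
            (ops x).Gp.l2 n U lam h ≤ B₁ * B9.pref6 ((geo9Y x).len y) n * (geo9Y x).cutSup h * Real.exp (-(δ₁ * (geo9Y x).dist y y')) * (geo9Y x).l2Norm lam) ∧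
        (∀ (n : Fin 4) (lam : (geo9Y x).Loc) (γ : ℝ), -4 ≤ γ → γ ≤ 4 → (ops x).Gp.glob n U lam γ ≤ B₁ * (geo9Y x).wNorm γ lam) ∧
        B9.Ineq343_345 (ops x).Gp Bβ Bε Bεβ δ₁ U)
    (h310 : ∀ (x : MemberY θ.d₆ θ.ℓ₆ θ.hd' θ.hL' θ.b₀ θ.b₁ Mstar) (U : (bg9Y (Matrix (Fin N) (Fin N) ℂ) (specialUnitaryUnits (Fin N)) x).Cfg),
      ((ops x).E310).Converges U → B9.Ineq342_346_347 (ops x).GA B₁ δ₁ U ∧ B9.Ineq343_345 (ops x).GA Bβ Bε Bεβ δ₁ U)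
    -- the remaining printed leaves, verbatim
    (c38 : B9.Cor38Printed c35Y geo9Y (bg9Y (Matrix (Fin N) (Fin N) ℂ) (specialUnitaryUnits (Fin N))) (fun x => (ops x).E37))
    (t39 : B9.Thm39Printed (θ.d₆ + 1) c35Y geo9Y (bg9Y (Matrix (Fin N) (Fin N) ℂ) (specialUnitaryUnits (Fin N))) (fun x => (ops x).EK39))
    (t310 : B9.Thm310Printed c35Y geo9Y (bg9Y (Matrix (Fin N) (Fin N) ℂ) (specialUnitaryUnits (Fin N))) (fun x => (ops x).E310))
    (hksum : B9.RWKernelSumYields (θ.d₆ + 1) geo9Y (bg9Y (Matrix (Fin N) (Fin N) ℂ) (specialUnitaryUnits (Fin N))) (fun x => (ops x).EK39)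
      (fun x => (ops x).Cinv))
    (t311 : B9.Thm311Printed c35Y geo9Y (bg9Y (Matrix (Fin N) (Fin N) ℂ) (specialUnitaryUnits (Fin N))) (fun x => (ops x).PosDef))
    (t312 : B9.Thm312Printed (θ.d₆ + 1) c35Y geo9Y (bg9Y (Matrix (Fin N) (Fin N) ℂ) (specialUnitaryUnits (Fin N))) (fun x => (ops x).GD)
      (fun x => (ops x).G₁) (fun x => (ops x).H) (fun x => (ops x).H₁) (fun x => (ops x).HasRWExp) (fun x => (ops x).HasRWExpH)
      (fun x => (ops x).PosDefK))
    (t313 : B9.Thm313Printed c35Y geo9Y (bg9Y (Matrix (Fin N) (Fin N) ℂ) (specialUnitaryUnits (Fin N))) (fun x => (ops x).GG)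
      (fun x => (ops x).HasRWExp) (fun x => (ops x).PosDefK))
    (t314 : B9.Thm314Printed c35Y geo9Y (bg9Y (Matrix (Fin N) (Fin N) ℂ) (specialUnitaryUnits (Fin N))) (fun x => (ops x).Kdiff) dOmegaY)
    (t315 : B9.Thm315FullPrinted c35Y geo9Y (bg9Y (Matrix (Fin N) (Fin N) ℂ) (specialUnitaryUnits (Fin N))) (fun x => (ops x).Ck) inΛY unitDistY
      (fun x => (ops x).GivenBy3185) (fun x => (ops x).HasRWExpC))
    (s349 : B9.Stmt349Printed (θ.d₆ + 1) c35Y geo9Y (bg9Y (Matrix (Fin N) (Fin N) ℂ) (specialUnitaryUnits (Fin N))) (fun x => (ops x).P349))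
    (s3132 : B9.Stmt3132Printed (θ.d₆ + 1) c35Y geo9Y (bg9Y (Matrix (Fin N) (Fin N) ℂ) (specialUnitaryUnits (Fin N))) (fun x => (ops x).QGQinv)
      (fun x => (ops x).QG1Qinv))
    (t314loc : B9Thm314.Thm314LocalPrinted c35Y geo9Y (bg9Y (Matrix (Fin N) (Fin N) ℂ) (specialUnitaryUnits (Fin N))) (fun x => (ops x).Kdiff)
      OmKY dOmegaY)
    (P : B12.RunParams) : Dag.B9_main (leavesP w P) :=
  b9_main_of_up_view₁₁B10YZW_of_obligations_t37supplied θ hθ Mstar ops ζ lamW w hup hGp_e hGp_h1 hC hGA_e hGA_h1 hGA_e4 hGA_h2 hGA_l2 hE4 hH2 hGp hGA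
    hB hg 𝔬 R H κ d α ρ Nc N' Cℓ K θ₀ B₀ δ₀ a₁ M₁ ML hα hα2 hN hN' hCℓ hK hB₀ hδ₀ ha₁ hM₁ hst hκ h261 h36 (fun x U h => (hE37 x U).2 h) c38 t39 t310
    (rwSumsYieldIneqs_of_conv342_pin θ.toStage3Params Mstar ops 𝔬 R H (const37_nonneg d hB₀ hN hN' hCℓ hK) ev evY hco0 hco1 hco2 hco3
      (fun x U h => (hE37 x U).1 h) hB₁ hδ₁ hCB hδ₁le hrest h310)
    hksum t311 t312 t313 t314 t315 s349 s3132 t314loc P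

end Pointed

end Summit.QuantumFields.YangMills.BalabanUVNodes.N06AtRecord11Obligations

end
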